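import Literature.Probability.LatticeModels.HalfPlaneClusterSides
import HarnessLib

/-!
# A `-`frame around a box kills the `+`clusters of the box (GH2000, Lemma 4.3, last step)

Topic `Probability/LatticeModels`. Georgii–Higuchi 2000, proof of Lemma 4.3 (orthogonal
butterflies), p. 1158: "the line touching lemma guarantees that the infinitely many doubly-infinite
`vertical' `+`paths passing through the horizontal axis are connected to each other in `π_{n,up}`
and `π_{-n,down}`. As `n` was arbitrary, it follows that almost surely each finite set is surrounded
by a `+`circuit, and an infinite `-`cluster cannot exist."

The deterministic content, with the signs interchanged (a frame of `-`sites kills `+`clusters):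
two vertical columns `{k} × [-(m+1), m+1]`, `{k'} × [-(m+1), m+1]` of `-`sites with
`k < -m`, `k' > m`, joined by a `-`lattice path inside `{x₂ ≥ m + 1}` and by one inside
`{x₂ ≤ -(m+1)}`, force every `+`cluster of `ℤ²` meeting `[-m, m]²` to be finite
(`siteCluster_plus_finite_of_minusFrame`; band/eye lemma `exists_mem_support_of_bandSemicircuits`).
Also: lattice walks inside a rectangle (`exists_walk_in_upperRect`), for the finite-energy step.

## References

* H.-O. Georgii, Y. Higuchi, *Percolation and number of phases in the two-dimensional Ising
  model*, J. Math. Phys. 41 (2000), Lemma 4.3 (proof) [GeorgiiHiguchi2000].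
-/

noncomputable section

open SimpleGraph
open Literature.Probability.Percolation

namespace Literature.Probability.LatticeModels

/-! ### Vertical runs -/

section Runs

/-- Vertices of an up-run. [folklore] -/
theorem frameUpRun_coords {z v : Site 2} {K : ℕ}
    (hv : v ∈ (Zhang.stepRun (Pi.single 1 1) Zhang.adj_add_unitStep.2.2.1 z K).support) :
    v 0 = z 0 ∧ z 1 ≤ v 1 ∧ v 1 ≤ z 1 + K := by
  obtain ⟨j, hj, hj0, hj1⟩ := Zhang.mem_support_stepRun.1 hv
  simp at hj0 hj1
  have : (j : ℤ) ≤ K := by exact_mod_cast hj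
  exact ⟨hj0, by omega, by omega⟩

/-- Vertices of a down-run. [folklore] -/
theorem frameDownRun_coords {z v : Site 2} {K : ℕ}
    (hv : v ∈ (Zhang.stepRun (-Pi.single 1 1) Zhang.adj_add_unitStep.2.2.2 z K).support) :
    v 0 = z 0 ∧ z 1 - K ≤ v 1 ∧ v 1 ≤ z 1 := by
  obtain ⟨j, hj, hj0, hj1⟩ := Zhang.mem_support_stepRun.1 hv
  simp at hj0 hj1
  have : (j : ℤ) ≤ K := by exact_mod_cast hj
  exact ⟨hj0, by omega, by omega⟩

/-- End of an up-run of `K` steps from `(a, b)`. [folklore] -/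
theorem frameUpRun_end (a b : ℤ) (K : ℕ) :
    ((fun w : Site 2 => w + Pi.single 1 1)^[K] (![a, b] : Site 2)) = ![a, b + K] := by
  rw [Site.eq_iff_two, Zhang.iterate_add_apply, Zhang.iterate_add_apply]; simp

/-- End of a down-run of `K` steps from `(a, b)`. [folklore] -/
theorem frameDownRun_end (a b : ℤ) (K : ℕ) :
    ((fun w : Site 2 => w + -Pi.single 1 1)^[K] (![a, b] : Site 2)) = ![a, b - K] := by
  rw [Site.eq_iff_two, Zhang.iterate_add_apply, Zhang.iterate_add_apply]; simp; ring

/-- **Lattice walks inside an upper rectangle**: every site `z` of `[-N, N] × [n, ∞)` is joined to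
`(0, n)` inside `[-N, N] × [n, z₂]`. [folklore] -/
theorem exists_walk_in_upperRect {N : ℕ} {n : ℤ} {z : Site 2} (hz0 : |z 0| ≤ N) (hz1 : n ≤ z 1) :
    ∃ p : (zdGraph 2).Walk (![0, n] : Site 2) z, ∀ v ∈ p.support, |v 0| ≤ N ∧ n ≤ v 1 ∧ v 1 ≤ z 1 := by
  rw [abs_le] at hz0
  -- horizontal run to `(z 0, n)`
  have hhor : ∃ p : (zdGraph 2).Walk (![0, n] : Site 2) ![z 0, n], ∀ v ∈ p.support, |v 0| ≤ N ∧ v 1 = n := by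
    rcases le_or_gt 0 (z 0) with h | h
    · set K : ℕ := (z 0).toNat with hK
      have hend : ((fun w : Site 2 => w + Pi.single 0 1)^[K] (![0, n] : Site 2)) = ![z 0, n] := by
        rw [Site.eq_iff_two, Zhang.iterate_add_apply, Zhang.iterate_add_apply]; simp [hK]; omega
      refine ⟨(Zhang.stepRun (Pi.single 0 1) Zhang.adj_add_unitStep.1 (![0, n]) K).copy rfl hend, fun v hv => ?_⟩
      rw [Walk.support_copy] at hv
      obtain ⟨j, hj, hj0, hj1⟩ := Zhang.mem_support_stepRun.1 hv
      simp at hj0 hj1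
      have : (j : ℤ) ≤ K := by exact_mod_cast hj
      exact ⟨by rw [abs_le]; omega, hj1⟩
    · set K : ℕ := (-z 0).toNat with hK
      have hend : ((fun w : Site 2 => w + -Pi.single 0 1)^[K] (![0, n] : Site 2)) = ![z 0, n] := by
        rw [Site.eq_iff_two, Zhang.iterate_add_apply, Zhang.iterate_add_apply]; simp [hK]; omega
      refine ⟨(Zhang.stepRun (-Pi.single 0 1) Zhang.adj_add_unitStep.2.1 (![0, n]) K).copy rfl hend, fun v hv => ?_⟩
      rw [Walk.support_copy] at hv
      obtain ⟨j, hj, hj0, hj1⟩ := Zhang.mem_support_stepRun.1 hv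
      simp at hj0 hj1
      have : (j : ℤ) ≤ K := by exact_mod_cast hj
      exact ⟨by rw [abs_le]; omega, hj1⟩
  obtain ⟨p₁, hp₁⟩ := hhor
  -- vertical run up to `z`
  set K : ℕ := (z 1 - n).toNat with hK
  have hend : ((fun w : Site 2 => w + Pi.single 1 1)^[K] (![z 0, n] : Site 2)) = z := by
    rw [frameUpRun_end, Site.eq_iff_two]; simp [hK]; omega
  refine ⟨p₁.append ((Zhang.stepRun (Pi.single 1 1) Zhang.adj_add_unitStep.2.2.1 (![z 0, n]) K).copy rfl hend),
    fun v hv => ?_⟩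
  rw [Walk.mem_support_append_iff, Walk.support_copy] at hv
  rcases hv with hv | hv
  · obtain ⟨h0, h1⟩ := hp₁ v hv
    exact ⟨h0, h1.ge, by rw [h1]; exact hz1⟩
  · obtain ⟨h0, h1, h2⟩ := frameUpRun_coords hv
    simp at h0 h1 h2
    have : (K : ℤ) = z 1 - n := by rw [hK]; omega
    exact ⟨by rw [h0, abs_le]; omega, h1, by omega⟩

end Runs

/-! ### The frame -/

section Frame

variable {ω : SpinConfig (Site 2)}

/-- **A `-`frame around `[-m, m]²` kills the `+`clusters of the box** (Georgii–Higuchi 2000, proof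
of Lemma 4.3, last step, signs interchanged): two `-`columns `{k} × [-(m+1), m+1]` (`k < -m`) and
`{k'} × [-(m+1), m+1]` (`k' > m`) joined by a `-`lattice path inside `{x₂ ≥ m+1}` and by one inside
`{x₂ ≤ -(m+1)}` force every `+`cluster of `ℤ²` through `[-m, m]²` to be finite. [cite: GeorgiiHiguchi2000, Lemma 4.3 (proof)] -/
theorem siteCluster_plus_finite_of_minusFrame {m : ℕ} {k k' : ℤ} (hk : k < -(m : ℤ)) (hk' : (m : ℤ) < k')
    (hcol : ∀ l : ℤ, -((m : ℤ) + 1) ≤ l → l ≤ (m : ℤ) + 1 → ω ![k, l] = -1)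
    (hcol' : ∀ l : ℤ, -((m : ℤ) + 1) ≤ l → l ≤ (m : ℤ) + 1 → ω ![k', l] = -1)
    (ptop : (zdGraph 2).Walk (![k, (m : ℤ) + 1] : Site 2) ![k', (m : ℤ) + 1])
    (hptop : ∀ v ∈ ptop.support, ω v = -1 ∧ (m : ℤ) + 1 ≤ v 1)
    (pbot : (zdGraph 2).Walk (![k, -((m : ℤ) + 1)] : Site 2) ![k', -((m : ℤ) + 1)])
    (hpbot : ∀ v ∈ pbot.support, ω v = -1 ∧ v 1 ≤ -((m : ℤ) + 1))
    {u : Site 2} (hu : -(m : ℤ) ≤ u 0 ∧ u 0 ≤ m ∧ -(m : ℤ) ≤ u 1 ∧ u 1 ≤ m) :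
    (siteCluster (zdGraph 2) (spinSites 1 ω) u).Finite := by
  classical
  have hax : ∀ (a l : ℤ) (v : Site 2), v 0 = a → v 1 = l → v = ![a, l] := fun a l v h0 h1 => by
    rw [Site.eq_iff_two]; exact ⟨by simp [h0], by simp [h1]⟩
  -- the upper `∗`-walk: up the column `k`, along `ptop`, down the column `k'`
  have hupL := frameUpRun_end k 0 (m + 1)
  have hdownR := frameDownRun_end k' ((m : ℤ) + 1) (m + 1)
  have hupL' : ((fun w : Site 2 => w + Pi.single 1 1)^[m + 1] (![k, 0] : Site 2)) = ![k, (m : ℤ) + 1] := by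
    rw [hupL]; push_cast; ring_nf
  have hdownR' : ((fun w : Site 2 => w + -Pi.single 1 1)^[m + 1] (![k', (m : ℤ) + 1] : Site 2)) = ![k', 0] := by
    rw [hdownR]; push_cast; ring_nf
  set αL : (zdGraph 2).Walk (![k, 0] : Site 2) ![k', 0] :=
    ((Zhang.stepRun (Pi.single 1 1) Zhang.adj_add_unitStep.2.2.1 (![k, 0]) (m + 1)).copy rfl hupL').append
      (ptop.append ((Zhang.stepRun (-Pi.single 1 1) Zhang.adj_add_unitStep.2.2.2 (![k', (m : ℤ) + 1]) (m + 1)).copy rfl hdownR'))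
    with hαL
  have hα : ∀ z ∈ (αL.mapLe zdGraph_le_zdStarGraph).support, ω z = -1 ∧ ¬ (-(m : ℤ) ≤ z 0 ∧ z 0 ≤ m ∧ z 1 ≤ m) := by
    intro z hz
    rw [Walk.support_mapLe_eq_support, hαL, Walk.mem_support_append_iff, Walk.support_copy,
      Walk.mem_support_append_iff, Walk.support_copy] at hz
    rcases hz with hz | hz | hz
    · obtain ⟨h0, h1, h2⟩ := frameUpRun_coords hz
      simp at h0 h1 h2
      refine ⟨by rw [hax k (z 1) z h0 rfl]; exact hcol (z 1) (by omega) (by omega), by omega⟩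
    · obtain ⟨h1, h2⟩ := hptop z hz
      exact ⟨h1, by omega⟩
    · obtain ⟨h0, h1, h2⟩ := frameDownRun_coords hz
      simp at h0 h1 h2
      refine ⟨by rw [hax k' (z 1) z h0 rfl]; exact hcol' (z 1) (by omega) (by omega), by omega⟩
  -- the lower `∗`-walk: down the column `k`, along `pbot`, up the column `k'`
  have hdownL := frameDownRun_end k 0 (m + 1)
  have hupR := frameUpRun_end k' (-((m : ℤ) + 1)) (m + 1)
  have hdownL' : ((fun w : Site 2 => w + -Pi.single 1 1)^[m + 1] (![k, 0] : Site 2)) = ![k, -((m : ℤ) + 1)] := by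
    rw [hdownL]; push_cast; ring_nf
  have hupR' : ((fun w : Site 2 => w + Pi.single 1 1)^[m + 1] (![k', -((m : ℤ) + 1)] : Site 2)) = ![k', 0] := by
    rw [hupR]; push_cast; ring_nf
  set αL' : (zdGraph 2).Walk (![k, 0] : Site 2) ![k', 0] :=
    ((Zhang.stepRun (-Pi.single 1 1) Zhang.adj_add_unitStep.2.2.2 (![k, 0]) (m + 1)).copy rfl hdownL').append
      (pbot.append ((Zhang.stepRun (Pi.single 1 1) Zhang.adj_add_unitStep.2.2.1 (![k', -((m : ℤ) + 1)]) (m + 1)).copy rfl hupR'))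
    with hαL'
  have hα' : ∀ z ∈ (αL'.mapLe zdGraph_le_zdStarGraph).support, ω z = -1 ∧ ¬ (-(m : ℤ) ≤ z 0 ∧ z 0 ≤ m ∧ -(m : ℤ) ≤ z 1) := by
    intro z hz
    rw [Walk.support_mapLe_eq_support, hαL', Walk.mem_support_append_iff, Walk.support_copy,
      Walk.mem_support_append_iff, Walk.support_copy] at hz
    rcases hz with hz | hz | hz
    · obtain ⟨h0, h1, h2⟩ := frameDownRun_coords hz
      simp at h0 h1 h2
      refine ⟨by rw [hax k (z 1) z h0 rfl]; exact hcol (z 1) (by omega) (by omega), by omega⟩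
    · obtain ⟨h1, h2⟩ := hpbot z hz
      exact ⟨h1, by omega⟩
    · obtain ⟨h0, h1, h2⟩ := frameUpRun_coords hz
      simp at h0 h1 h2
      refine ⟨by rw [hax k' (z 1) z h0 rfl]; exact hcol' (z 1) (by omega) (by omega), by omega⟩
  -- the `+`cluster of `u` cannot leave a box containing the frame
  set α := αL.mapLe zdGraph_le_zdStarGraph with hαdef
  set α' := αL'.mapLe zdGraph_le_zdStarGraph with hα'def
  by_contra hinf
  rw [Set.not_finite] at hinf
  obtain ⟨H, hH⟩ := (eventually_subset_box_holds (d := 2) (α.support.toFinset ∪ α'.support.toFinset)).exists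
  obtain ⟨w, hw, hwH⟩ := hinf.exists_notMem_finset (box 2 H)
  have hu_mem : u ∈ siteCluster (zdGraph 2) (spinSites 1 ω) u := (mem_siteCluster_self_iff _ _ _).2 hw.1
  obtain ⟨β, hβ⟩ := exists_walk_of_mem_siteCluster hu_mem hw
  obtain ⟨z, hzβ, hz⟩ := exists_mem_support_of_bandSemicircuits (m := m) (c₁ := -(m : ℤ)) (c₂ := m)
    hk hk' (xL := ![k, 0]) (xR := ![k', 0]) (by simp) (by simp) (by simp) (by simp)
    α (fun z hz => (hα z hz).2) α' (fun z hz => (hα' z hz).2)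
    (H := H) (fun z hz => hH (Finset.mem_union_left _ (List.mem_toFinset.2 hz)))
    (fun z hz => hH (Finset.mem_union_right _ (List.mem_toFinset.2 hz)))
    (u := u) (w := w) hu hwH β
  have hzO : ω z = 1 := hβ z hzβ
  rcases hz with hz | hz
  · have := (hα z hz).1; rw [hzO] at this; exact absurd this (by decide)
  · have := (hα' z hz).1; rw [hzO] at this; exact absurd this (by decide)

end Frame

end Literature.Probability.LatticeModels
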